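import Summits.BirchSwinnertonDyer.BirchSwinnertonDyer.Theorems.RamifiedHeegnerPairLeafRankOneUpperAtThreePartnerLower
import Summits.BirchSwinnertonDyer.BirchSwinnertonDyer.Theorems.RamifiedHeegnerPairLeafRankOneUpperAtThreeTwoSplitReading
import HarnessLib

/-!
# Route `RamifiedHeegnerPair`, crux U₁ `LeafRankOneUpperAtThree` (stmt-BirchSwinnertonDyer-26022), line `splitkolyvagin` —
# the S2 EXIT on the PARTNER-LOWER road: U₁ BY NAME ⟸ PUB⁺ ∧ three named print facts ∧ Σ★″ ∧ PL₀|₂, where PL₀|₂ is rhp-p2 g7's tight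
# fourth-stub form PL₀ (a Heegner rank-zero partner carrying its LOWER half) with the partner field ALSO SPLITTING `2`; PL₀|₂ ⟸ L₀ and ⟸ the leaf

HONEST FRAMING. Theorems only; helper file (`--supports stmt-BirchSwinnertonDyer-26022 --as helper`); nothing is booked,
no item is closed, BSD is not proved for any curve; CONDITIONAL on every displayed input. Lead prover bsd-line-rhp-p2 g8,
2026-08-28. On the road OF RECORD (L₀, Friedberg–Hoffstein field with `2` split) the reading-grade child S2 (27492) already left U₁
modulo the three facts (p638868 / p639230). On g7's PARTNER-LOWER road (p634493) the Heegner field is the one SUPPLIED by the datum PL₀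
(odd `d_K` only), where `2` may be inert; this file re-runs that road with the datum PL₀|₂ := PL₀ ∧ «`2` splits in `K`»
(`SatisfiesHeegnerHypothesis 2 K`), so that the Jetchev reading is again consumed only where `bsd-potss` proved it from the facts:

* §1 `leafRankOneUpper_three_of_sigmaAtDatumTwoSplit_of_partnerLowerTwoSplit` — p634493 §1 over PL₀|₂, the Σ-callback told `2` splits.
* §2 `leafRankOneUpper_three_monoCarrier_of_twoSplitReading_of_partnerLowerTwoSplit` — p634493 §3 with S2 ↦ S2|₂ and PL₀ ↦ PL₀|₂.
* §3 `leafRankOneUpper_three_of_latticeOptimal_of_namedFacts_of_sigmaStar_of_partnerLowerTwoSplit` — p634493 §4 with S2 ↦ the three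
  named facts (through `twoSplitReading_of_namedFacts`) and PL₀ ↦ PL₀|₂.
* §4 **`leafRankOneUpperAtThree_of_pubManin_of_namedFacts_of_sigmaStar_of_partnerLowerTwoSplit`** : `LeafRankOnePrintedInputsAtThree →
  prop37_2_frobeniusCongruence → (∀ K, poitouTate_selmerStructure_duality_conj K) → Gross1991_heegnerPoint_sub_ratTorsion_mem_E0_imageFree →
  LeafSigmaStarDivisibilityAtThreeOptimalOffRows → PL₀|₂ → LeafRankOneUpperAtThree` — NO S2, NO L₀; and the glue 27494 modulo PL₀|₂ + facts.
* §5 the sources of PL₀|₂: `partnerLowerTwoSplit_of_lowerRankZero` (⟸ L₀, Friedberg–Hoffstein with `2` split) and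
  `partnerLowerTwoSplit_of_wAllExclAddGssAtThree` (⟸ the leaf: TIGHT, no surplus over BSD₃). (The twist-unit source needs a twist-unit field
  splitting `2` — trib-w-rhp g11's census: 353 of 355 rank-one Gss2 classes have one with `d ≡ 1 (mod 8)` — not re-typed here.)

NET: modulo print ∪ {the three facts}, **U₁ ⟸ Σ★″ ∧ PL₀|₂** with PL₀|₂ tight. References: [cite: Jetchev2008, Conj. 1.3, Thm. 1.4, Cor. 1.5
(p. 812)] [cite: GrossLMS1991, Prop. 3.7 (2) (p. 240), §6 p. 245] [cite: GrossZagier1986, III (3.1); Thm. I.(6.3) and (7.3)] [cite: MilneADT2006,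
Ch. I, Thm. 4.10(b); Thm. I.7.3] [cite: MatarNekovar2019, Thm. 0.7 (p. 456)] [cite: Mazur1978, Cor. 4.1] [cite: FriedbergHoffstein1995, Thm. B]
[cite: Miller2011LMS, §1 and Def. 1.1].
-/

-- D-0017: single-problem summit, so `Summit.BirchSwinnertonDyer.BirchSwinnertonDyer.…` repeats a namespace BY DESIGN.
set_option linter.dupNamespace false
set_option autoImplicit false

noncomputable section

open scoped Classical NumberField

open WeierstrassCurve IsDedekindDomain IsDedekindDomain.HeightOneSpectrum NumberField
  Rat.HeightOneSpectrum Literature Literature.NumberTheory.EllipticCurves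
  Literature.NumberTheory.EllipticCurves.ModularForms
  Literature.NumberTheory.EllipticCurves.Rank1Residual
  Literature.NumberTheory.EllipticCurves.Rank1Residual.Typed
  Literature.NumberTheory.EllipticCurves.KrizLi2019
  Literature.NumberTheory.QuadraticFields
  Summit.BirchSwinnertonDyer.Rank1Residual
  Summit.BirchSwinnertonDyer.Rank1Residual.Additive
  Summit.BirchSwinnertonDyer.Rank1Residual.X11b.Three
  Summit.BirchSwinnertonDyer.BirchSwinnertonDyer.Theses.RamifiedHeegnerPair
  Summit.BirchSwinnertonDyer.BirchSwinnertonDyer.Theorems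
  Summit.BirchSwinnertonDyer.BirchSwinnertonDyer.Theorems.SchneiderFree

namespace Summit.BirchSwinnertonDyer.BirchSwinnertonDyer.Theorems.RamifiedPairUpperBound

/-! ## §1 One datum: U₁ at `W` from Σ at the datum over the PARTNER-LOWER field in which `2` splits -/

/-- **U₁ AT `W` from Σ AT ONE PARAMETRISATION DATUM over a partner-lower field splitting `2`.** p634493 §1 with the datum PL₀|₂(W) (`hPL`:
a Heegner field `K` of odd discriminant IN WHICH `2` SPLITS, with `L(W^{(d_K)},1) ≠ 0` and a globally minimal model `Wd` of the twist carrying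
its LOWER half) and the Σ-callback also handed `SatisfiesHeegnerHypothesis 2 K`. CONDITIONAL on every displayed input; nothing asserted.
[cite: GrossZagier1986, Thm. I.(6.3) and (7.3)] [cite: MatarNekovar2019, Thm. 0.7 (p. 456)] [cite: Jetchev2008, Conj. 1.3 (p. 812)] [cite: Miller2011LMS, Def. 1.1] -/
theorem leafRankOneUpper_three_of_sigmaAtDatumTwoSplit_of_partnerLowerTwoSplit
    (hGZ : ∀ (N : ℕ) [NeZero N] (W : WeierstrassCurve ℚ) (K : Type) [Field K] [NumberField K],
      gross_zagier N W K)
    (hKo : ∀ (N : ℕ) [NeZero N] (W : WeierstrassCurve ℚ) (K : Type) [Field K] [NumberField K],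
      kolyvagin N W K)
    (hGZK : rank_eq_analyticRank_of_analyticRank_le_one) (hmod : hasEntireLFunction_rat)
    (hGZ73 : GrossZagier1986_thm_I_7_3)
    (hMN : MatarNekovar2019.thm07_padicValNat_card_sha_primary_add_le_of_globalDivisibility_of_irreducible)
    (W : WeierstrassCurve ℚ) [W.IsElliptic] [W.IsGloballyMinimal] [NeZero (W.conductorNorm ℤ)]
    (hCM : ¬ W.HasCM) (hadd : Addv W 3) (hsub : SubGss W 3) (hr : W.analyticRank = 1)
    (Dt : ModularParametrizationData W (W.conductorNorm ℤ))
    (hPL : ∃ (K : Type) (_ : Field K) (_ : NumberField K) (Wd : WeierstrassCurve ℚ) (_ : Wd.IsElliptic) (_ : Wd.IsGloballyMinimal),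
      IsImaginaryQuadratic K ∧ Odd (NumberField.discr K) ∧ SatisfiesHeegnerHypothesis (W.conductorNorm ℤ) K ∧
      SatisfiesHeegnerHypothesis 2 K ∧ (W.quadraticTwist (NumberField.discr K : ℚ)).entireLFunction 1 ≠ 0 ∧
      (∃ C : VariableChange ℚ, C • W.quadraticTwist (NumberField.discr K : ℚ) = Wd) ∧ MissingLowerBoundAt Wd 3)
    (hSig : ∀ (K : Type) [Field K] [NumberField K]
      (H : HeegnerDatum (W.conductorNorm ℤ) (NumberField.discr K)) (ι : K →+* ℂ) (P : (W.baseChange K).toAffine.Point),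
      IsImaginaryQuadratic K → SatisfiesHeegnerHypothesis (W.conductorNorm ℤ) K → SatisfiesHeegnerHypothesis 2 K →
      (W.quadraticTwist (NumberField.discr K : ℚ)).entireLFunction 1 ≠ 0 →
      WeierstrassCurve.Affine.Point.map ι.toRatAlgHom P = heegnerPointComplex Dt H → ¬ IsOfFinAddOrder P →
      Odd (NumberField.discr K) →
      ∀ (s' : ℕ), s' ≤ padicValNat 3 W.tamagawaProduct + padicValNat 3 Dt.c.natAbs →
      ∀ (n : ℕ) (d : KolyvaginHeegnerData Dt H.β ι n), Squarefree n →
      (∀ ℓ ∈ n.primeFactors, Zhang2014.IsKolyvaginPrime (W.conductorNorm ℤ) W K 3 ℓ ∧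
        s' ≤ Zhang2014.kolyvaginIndex W 3 ℓ) → Koly.PDiv d 3 s') :
    MissingUpperBoundAt W 3 := by
  obtain ⟨K, _, _, Wd, _, _, hK, hodd, hHN, hH2, hLt, hC, hlow⟩ := hPL
  -- the Heegner datum and the `K`-rational Heegner point of `Dt`
  obtain ⟨β, hβ⟩ := exists_dvd_sq_sub_discr_holds (W.conductorNorm ℤ) K hK hHN
  obtain ⟨H, -⟩ := nonempty_heegnerDatum_holds (W.conductorNorm ℤ) K hK hβ
  obtain ⟨ι⟩ : Nonempty (K →+* ℂ) := inferInstance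
  obtain ⟨P, hP⟩ := heegnerPointComplex_mem_range_map_holds (W.conductorNorm ℤ) W K hK hHN Dt H ι
  -- the Heegner point is non-torsion (Gross–Zagier: `L′(E/K,1) = L′(E,1)·L(E^{(d_K)},1) ≠ 0`)
  have hL0W : W.entireLFunction 1 = 0 := entireLFunction_one_eq_zero_of_analyticRank_eq_one hr
  obtain ⟨-, hderiv⟩ := leadingLCoeff_eq_deriv_of_analyticRank_eq_one hr
  have hLK : LDerivEK W K ≠ 0 := by
    rw [lDerivEK_eq_deriv_mul W K hmod hL0W]; exact mul_ne_zero hderiv hLt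
  have hnt : ¬ IsOfFinAddOrder P :=
    (lDerivEK_ne_zero_iff_not_isOfFinAddOrder W (W.conductorNorm ℤ) K (hGZ _ W K) hK hHN
      ⟨Dt, H, ι, hP⟩).mp hLK
  exact leafRankOneUpper_three_of_globalDivisibility_of_twistLower hGZ hKo hGZK hmod hGZ73 hMN W hCM hadd hsub hr
    K Dt H ι P Wd hK hodd hHN hLt hP hC (fun s' hs' n d hn hℓ ↦ hSig K H ι P hK hHN hH2 hLt hP hnt hodd s' hs' n d hn hℓ) hlow

/-! ## §2 The mono-multiplicative-carrier rows: U₁ ⟸ print + S2|₂ + PL₀|₂(W) -/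

/-- **U₁ AT `W` ON A MONO-MULTIPLICATIVE-CARRIER ROW WITH A MANIN-CLEAN DATUM, from the 2-SPLIT reading S2|₂ and PL₀|₂(W)** — p634493 §3
with S2 ↦ S2|₂ (`hD₂`: one extra binder «`SatisfiesHeegnerHypothesis 2 K`») and the partner field splitting `2`. CONDITIONAL; nothing asserted.
[cite: Jetchev2008, Thm. 1.4 and Cor. 1.5 (p. 812)] [cite: MatarNekovar2019, Thm. 0.7 (p. 456)] [cite: GrossZagier1986, Thm. I.(6.3) and (7.3)]
[cite: Miller2011LMS, Def. 1.1] -/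
theorem leafRankOneUpper_three_monoCarrier_of_twoSplitReading_of_partnerLowerTwoSplit
    (hGZ : ∀ (N : ℕ) [NeZero N] (W : WeierstrassCurve ℚ) (K : Type) [Field K] [NumberField K],
      gross_zagier N W K)
    (hKo : ∀ (N : ℕ) [NeZero N] (W : WeierstrassCurve ℚ) (K : Type) [Field K] [NumberField K],
      kolyvagin N W K)
    (hGZK : rank_eq_analyticRank_of_analyticRank_le_one) (hmod : hasEntireLFunction_rat)
    (hGZ73 : GrossZagier1986_thm_I_7_3)
    (hMN : MatarNekovar2019.thm07_padicValNat_card_sha_primary_add_le_of_globalDivisibility_of_irreducible)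
    (hD₂ : ∀ (W : WeierstrassCurve ℚ) [W.IsElliptic] [W.IsGloballyMinimal] [NeZero (W.conductorNorm ℤ)],
      ¬ W.HasCM →
      ∀ (K : Type) [Field K] [NumberField K], IsImaginaryQuadratic K →
      NumberField.discr K ≠ -3 → NumberField.discr K ≠ -4 →
      SatisfiesHeegnerHypothesis (W.conductorNorm ℤ) K → SatisfiesHeegnerHypothesis 2 K →
      ∀ (p : ℕ) [Fact p.Prime], p ≠ 2 → Addv W p → 0 ≤ padicValRat p W.j →
      W.HasIrreducibleModPGaloisRep p →
      ¬ p ∣ (W.baseChange ℚ_[p]).localTamagawaNumber ℤ_[p] →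
      (∀ (q' : ℕ) [Fact q'.Prime], q' ∣ W.conductorNorm ℤ →
        p ∣ (W.baseChange ℚ_[q']).localTamagawaNumber ℤ_[q'] → ¬ q' ^ 2 ∣ W.conductorNorm ℤ) →
      ∀ (Dt : ModularParametrizationData W (W.conductorNorm ℤ)) (β : ℤ) (ι : K →+* ℂ)
        (d₁ : KolyvaginHeegnerData Dt β ι 1), ¬ IsOfFinAddOrder d₁.derivedPoint →
      ∀ (q : ℕ) [Fact q.Prime], q ∣ W.conductorNorm ℤ → ¬ q ^ 2 ∣ W.conductorNorm ℤ → q ≠ p →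
      ∀ (s : ℕ), s ≤ padicValNat p ((W.baseChange ℚ_[q]).localTamagawaNumber ℤ_[q]) →
      ∀ (n : ℕ) (d : KolyvaginHeegnerData Dt β ι n), Squarefree n →
        (∀ ℓ ∈ n.primeFactors, Zhang2014.IsKolyvaginPrime (W.conductorNorm ℤ) W K p ℓ ∧
          s ≤ Zhang2014.kolyvaginIndex W p ℓ) →
        ∃ Q : (W.baseChange (ringClassField K ι n)).toAffine.Point,
          ((p ^ s : ℕ) : ℤ) • Q = d.derivedPoint)
    (W : WeierstrassCurve ℚ) [W.IsElliptic] [W.IsGloballyMinimal] [NeZero (W.conductorNorm ℤ)]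
    (hCM : ¬ W.HasCM) (hadd : Addv W 3) (hsub : SubGss W 3) (hr : W.analyticRank = 1)
    (q : ℕ) [Fact q.Prime] (hqN : q ∣ W.conductorNorm ℤ) (hq2 : ¬ q ^ 2 ∣ W.conductorNorm ℤ)
    (hmono : padicValNat 3 W.tamagawaProduct ≤ padicValNat 3 ((W.baseChange ℚ_[q]).localTamagawaNumber ℤ_[q]))
    (htam : ∀ (q' : ℕ) [Fact q'.Prime], q' ∣ W.conductorNorm ℤ →
      3 ∣ (W.baseChange ℚ_[q']).localTamagawaNumber ℤ_[q'] → ¬ q' ^ 2 ∣ W.conductorNorm ℤ)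
    (Dt : ModularParametrizationData W (W.conductorNorm ℤ)) (hc : ¬ (3 : ℤ) ∣ Dt.c)
    (hPL : ∃ (K : Type) (_ : Field K) (_ : NumberField K) (Wd : WeierstrassCurve ℚ) (_ : Wd.IsElliptic) (_ : Wd.IsGloballyMinimal),
      IsImaginaryQuadratic K ∧ Odd (NumberField.discr K) ∧ SatisfiesHeegnerHypothesis (W.conductorNorm ℤ) K ∧
      SatisfiesHeegnerHypothesis 2 K ∧ (W.quadraticTwist (NumberField.discr K : ℚ)).entireLFunction 1 ≠ 0 ∧
      (∃ C : VariableChange ℚ, C • W.quadraticTwist (NumberField.discr K : ℚ) = Wd) ∧ MissingLowerBoundAt Wd 3) :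
    MissingUpperBoundAt W 3 := by
  have hirr : W.HasIrreducibleModPGaloisRep 3 := (classX4_three_of_addv_of_subGss W hadd hsub).2.2
  have hj : 0 ≤ padicValRat 3 W.j := padicValRat_j_nonneg_of_subGss_three W hadd hsub
  have hc3 : ¬ 3 ∣ (W.baseChange ℚ_[3]).localTamagawaNumber ℤ_[3] :=
    not_three_dvd_localTamagawaNumber_three_of_subGss W hadd hsub
  have h3N : 3 ∣ W.conductorNorm ℤ :=
    (W.dvd_conductorNorm_iff_not_hasGoodReductionAtPrime 3).mpr (not_good_of_addv W 3 hadd)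
  refine leafRankOneUpper_three_of_sigmaAtDatumTwoSplit_of_partnerLowerTwoSplit hGZ hKo hGZK hmod hGZ73 hMN W hCM hadd hsub hr
    Dt hPL ?_
  intro K _ _ H ι P hK hHN hH2 hLt hP hnt hodd s' hs' n d hn hℓ
  rcases Nat.eq_zero_or_pos s' with hs0 | hspos
  · subst hs0
    exact koly_pDiv_zero d 3
  have hc0 : padicValNat 3 Dt.c.natAbs = 0 :=
    padicValNat.eq_zero_of_not_dvd fun h ↦ hc (Int.ofNat_dvd_left.mpr h)
  have hsq : s' ≤ padicValNat 3 ((W.baseChange ℚ_[q]).localTamagawaNumber ℤ_[q]) := by omega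
  have hq3 : q ≠ 3 := by
    rintro rfl
    have hpos : 0 < padicValNat 3 ((W.baseChange ℚ_[3]).localTamagawaNumber ℤ_[3]) := by omega
    exact hc3 (dvd_of_one_le_padicValNat hpos)
  have h3 : NumberField.discr K ≠ -3 := by
    intro h
    exact (X11b.Three.not_dvd_discr_and_not_dvd_torsionOrder_of_heegner hK hHN (by decide) h3N).1
      (h ▸ ⟨-1, by norm_num⟩)
  have h4 : NumberField.discr K ≠ -4 := by
    intro h
    rw [h] at hodd
    exact (Int.not_odd_iff_even.mpr ⟨-2, by norm_num⟩) hodd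
  obtain ⟨d₁⟩ := exists_kolyvaginHeegnerData_one
    (phi_heegnerTau_mem_singularModuliField_holds (W.conductorNorm ℤ) W K) hK Dt H.β ι H.dvd_sq_sub
  have hPd : d₁.toGeomPoints d₁.derivedPoint = toGeomPoints (W.baseChange K) P :=
    X11b.KolyvaginBottom.toGeomPoints_derivedPoint_one_eq
      (heegnerPointOfConductor_one_galoisConj_holds (W.conductorNorm ℤ) W K) hK hHN hP d₁ rfl
  have hy₁ : ¬ IsOfFinAddOrder d₁.derivedPoint := by
    intro hfin
    apply hnt
    have h1 : IsOfFinAddOrder (d₁.toGeomPoints d₁.derivedPoint) := d₁.toGeomPoints.isOfFinAddOrder hfin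
    rw [hPd] at h1
    exact (toGeomPoints_injective (W.baseChange K)).isOfFinAddOrder_iff.mp h1
  exact hD₂ W hCM K hK h3 h4 hHN hH2 3 (by decide) hadd hj hirr hc3 htam Dt H.β ι d₁ hy₁ q hqN hq2 hq3 s' hsq n d hn hℓ

/-! ## §3 At a lattice-optimal member: U₁ ⟸ print⁺ + three named facts + Σ★″ + PL₀|₂(W) -/

/-- **U₁ AT A LEAF CURVE CARRYING A LATTICE-OPTIMAL DATUM ⟸ print⁺ + {Gross 3.7 (2), Poitou–Tate, GZ86 III (3.1)} + Σ★″ (27493) + PL₀|₂(W).**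
p634493 §4 with the reading S2 DISCHARGED (on the row: §2 fed by `twoSplitReading_of_namedFacts`) and the partner field splitting `2`; off the row:
§1 with Σ★″ at the datum. CONDITIONAL; nothing asserted. [cite: Jetchev2008, Conj. 1.3, Thm. 1.4 (p. 812)] [cite: GrossLMS1991, Prop. 3.7 (2)]
[cite: MilneADT2006, Ch. I, Thm. 4.10(b)] [cite: MatarNekovar2019, Thm. 0.7 (p. 456)] [cite: Mazur1978, Cor. 4.1] [cite: Miller2011LMS, Def. 1.1] -/
theorem leafRankOneUpper_three_of_latticeOptimal_of_namedFacts_of_sigmaStar_of_partnerLowerTwoSplit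
    (hGZ : ∀ (N : ℕ) [NeZero N] (W : WeierstrassCurve ℚ) (K : Type) [Field K] [NumberField K],
      gross_zagier N W K)
    (hKo : ∀ (N : ℕ) [NeZero N] (W : WeierstrassCurve ℚ) (K : Type) [Field K] [NumberField K],
      kolyvagin N W K)
    (hGZK : rank_eq_analyticRank_of_analyticRank_le_one) (hmod : hasEntireLFunction_rat)
    (hGZ73 : GrossZagier1986_thm_I_7_3)
    (hMN : MatarNekovar2019.thm07_padicValNat_card_sha_primary_add_le_of_globalDivisibility_of_irreducible)
    (hnf : exists_isNewformOf)
    (hM : mazur_not_dvd_maninConstant_of_odd) (hAU : abbesUllmo_not_dvd_maninConstant_of_not_dvd_level)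
    (hC2 : cesnavicius_not_two_dvd_maninConstant_of_two_dvd_level)
    (h37 : GrossLMS1991.prop37_2_frobeniusCongruence)
    (hPT : ∀ (K : Type) [Field K] [NumberField K],
      Literature.NumberTheory.GaloisCohomology.poitouTate_selmerStructure_duality_conj K)
    (hF1 : Gross1991_heegnerPoint_sub_ratTorsion_mem_E0_imageFree)
    (hStar : LeafSigmaStarDivisibilityAtThreeOptimalOffRows)
    (W : WeierstrassCurve ℚ) [W.IsElliptic] [W.IsGloballyMinimal] [NeZero (W.conductorNorm ℤ)]
    (hCM : ¬ W.HasCM) (hadd : Addv W 3) (hsub : SubGss W 3) (hr : W.analyticRank = 1)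
    (Dt : ModularParametrizationData W (W.conductorNorm ℤ))
    (hopt : ∀ z ∈ Dt.L.lattice, ∃ w ∈ periodLattice Dt.f, z = Dt.c * w)
    (hPL : ∃ (K : Type) (_ : Field K) (_ : NumberField K) (Wd : WeierstrassCurve ℚ) (_ : Wd.IsElliptic) (_ : Wd.IsGloballyMinimal),
      IsImaginaryQuadratic K ∧ Odd (NumberField.discr K) ∧ SatisfiesHeegnerHypothesis (W.conductorNorm ℤ) K ∧
      SatisfiesHeegnerHypothesis 2 K ∧ (W.quadraticTwist (NumberField.discr K : ℚ)).entireLFunction 1 ≠ 0 ∧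
      (∃ C : VariableChange ℚ, C • W.quadraticTwist (NumberField.discr K : ℚ) = Wd) ∧ MissingLowerBoundAt Wd 3) :
    MissingUpperBoundAt W 3 := by
  by_cases hrow : ((∃ (q : ℕ) (_ : Fact q.Prime), q ∣ W.conductorNorm ℤ ∧ ¬ q ^ 2 ∣ W.conductorNorm ℤ ∧
          padicValNat 3 W.tamagawaProduct ≤ padicValNat 3 ((W.baseChange ℚ_[q]).localTamagawaNumber ℤ_[q])) ∧
        (∀ (q' : ℕ) [Fact q'.Prime], q' ∣ W.conductorNorm ℤ →
          3 ∣ (W.baseChange ℚ_[q']).localTamagawaNumber ℤ_[q'] → ¬ q' ^ 2 ∣ W.conductorNorm ℤ))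
  · obtain ⟨⟨q, _, hqN, hq2, hmono⟩, htam⟩ := hrow
    exact leafRankOneUpper_three_monoCarrier_of_twoSplitReading_of_partnerLowerTwoSplit hGZ hKo hGZK hmod hGZ73 hMN
      (twoSplitReading_of_namedFacts h37 hPT hF1) W hCM hadd hsub hr q hqN hq2 hmono htam Dt
      (not_three_dvd_c_of_latticeOptimal_of_subGss hM hAU hC2 hnf W Dt hopt hadd hsub) hPL
  · exact leafRankOneUpper_three_of_sigmaAtDatumTwoSplit_of_partnerLowerTwoSplit hGZ hKo hGZK hmod hGZ73 hMN W hCM hadd hsub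
      hr Dt hPL (fun K _ _ H ι P hK hHN _ hLt hP hnt hodd s' hs' n d hn hℓ ↦
        sigmaOptOffRows_of_sigmaStarOptOffRows hStar W (W.conductorNorm ℤ) K Dt H ι P hCM hadd hsub hr rfl hopt hrow hK
          hHN hLt hP hnt hodd s' hs' n d hn hℓ)

/-! ## §4 The class statement BY NAME: `LeafRankOneUpperAtThree` ⟸ PUB⁺ ∧ three named facts ∧ Σ★″ ∧ PL₀|₂ — NO S2, NO L₀ -/

/-- **`LeafRankOneUpperAtThree` (26022) BY NAME ⟸ PUB⁺ (27491) ∧ {Gross 1991 Prop. 3.7 (2), Poitou–Tate duality for Selmer structures (∀ K),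
[GZ86 III (3.1)] image-free} ∧ Σ★″ (27493) ∧ PL₀|₂**, PL₀|₂ := every non-CM leaf curve of analytic rank one has a Heegner partner of analytic rank
zero, over a field in which `2` splits, carrying its lower half (spelled inline). Optimal member `W₀ ∼ W` (modularity; PL₀|₂ applies AT `W₀`), §3
there, Cassels + GZK + Version L back. NO S2 (27492), NO L₀ (26023). CONDITIONAL; U₁ stays OPEN; BSD is not proved.
[cite: Jetchev2008, Conj. 1.3, Thm. 1.4 (p. 812)] [cite: GrossLMS1991, Prop. 3.7 (2) (p. 240)] [cite: MilneADT2006, Ch. I, Thm. 4.10(b); Thm. I.7.3]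
[cite: GrossZagier1986, III (3.1)] [cite: MatarNekovar2019, Thm. 0.7 (p. 456)] [cite: Mazur1978, Cor. 4.1] [cite: Miller2011LMS, Def. 1.1] -/
theorem leafRankOneUpperAtThree_of_pubManin_of_namedFacts_of_sigmaStar_of_partnerLowerTwoSplit
    (hpub : LeafRankOnePrintedInputsAtThree)
    (h37 : GrossLMS1991.prop37_2_frobeniusCongruence)
    (hPT : ∀ (K : Type) [Field K] [NumberField K],
      Literature.NumberTheory.GaloisCohomology.poitouTate_selmerStructure_duality_conj K)
    (hF1 : Gross1991_heegnerPoint_sub_ratTorsion_mem_E0_imageFree)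
    (hStar : LeafSigmaStarDivisibilityAtThreeOptimalOffRows)
    (hPL : ∀ (W : WeierstrassCurve ℚ) [W.IsElliptic] [W.IsGloballyMinimal], ¬ W.HasCM →
      Literature.NumberTheory.EllipticCurves.Rank1Residual.Addv W 3 →
      Summit.BirchSwinnertonDyer.Rank1Residual.Additive.SubGss W 3 → W.analyticRank = 1 →
      ∃ (K : Type) (_ : Field K) (_ : NumberField K) (Wd : WeierstrassCurve ℚ) (_ : Wd.IsElliptic) (_ : Wd.IsGloballyMinimal),
        IsImaginaryQuadratic K ∧ Odd (NumberField.discr K) ∧ SatisfiesHeegnerHypothesis (W.conductorNorm ℤ) K ∧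
        SatisfiesHeegnerHypothesis 2 K ∧ (W.quadraticTwist (NumberField.discr K : ℚ)).entireLFunction 1 ≠ 0 ∧
        (∃ C : VariableChange ℚ, C • W.quadraticTwist (NumberField.discr K : ℚ) = Wd) ∧ MissingLowerBoundAt Wd 3) :
    LeafRankOneUpperAtThree := by
  intro W _ _ hCM hadd hsub hr
  obtain ⟨hGZ, hKo, hGZK, hmod, hGZ73, hMN, hnf, -, -, hCassels, hM, hAU, hC2⟩ := hpub
  obtain ⟨W₀, hW₀, hW₀', N, hN0, D₀, hiso, hN₀, -, hopt, hCM₀, hadd₀, hsub₀, hr₀⟩ :=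
    exists_optimal_leaf_member hnf W hCM hadd hsub
  haveI := hW₀
  haveI := hW₀'
  haveI := hN0
  have h₀ : MissingUpperBoundAt W₀ 3 := by
    subst hN₀
    exact leafRankOneUpper_three_of_latticeOptimal_of_namedFacts_of_sigmaStar_of_partnerLowerTwoSplit hGZ hKo hGZK hmod hGZ73
      hMN hnf hM hAU hC2 h37 hPT hF1 hStar W₀ hCM₀ hadd₀ hsub₀ (hr₀.trans hr) D₀ hopt (hPL W₀ hCM₀ hadd₀ hsub₀ (hr₀.trans hr))
  exact missingUpperBoundAt_of_isIsogenous_of_analyticRank_le_one hCassels hGZK hmod (le_of_eq hr) hiso h₀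

/-- **G₁ modulo PL₀|₂ and the three facts**: the generated glue `LeafRankOneUpperAtThreeGlue` (PUB⁺ → S2 → Σ★″ → U₁, item 27494) with its S2 argument
IDLE. CONDITIONAL; closes nothing. [cite: Jetchev2008, Conj. 1.3 (p. 812)] [cite: GrossLMS1991, Prop. 3.7 (2)] [cite: Miller2011LMS, Def. 1.1] -/
theorem leafRankOneUpperAtThreeGlue_of_namedFacts_of_partnerLowerTwoSplit
    (h37 : GrossLMS1991.prop37_2_frobeniusCongruence)
    (hPT : ∀ (K : Type) [Field K] [NumberField K],
      Literature.NumberTheory.GaloisCohomology.poitouTate_selmerStructure_duality_conj K)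
    (hF1 : Gross1991_heegnerPoint_sub_ratTorsion_mem_E0_imageFree)
    (hPL : ∀ (W : WeierstrassCurve ℚ) [W.IsElliptic] [W.IsGloballyMinimal], ¬ W.HasCM →
      Literature.NumberTheory.EllipticCurves.Rank1Residual.Addv W 3 →
      Summit.BirchSwinnertonDyer.Rank1Residual.Additive.SubGss W 3 → W.analyticRank = 1 →
      ∃ (K : Type) (_ : Field K) (_ : NumberField K) (Wd : WeierstrassCurve ℚ) (_ : Wd.IsElliptic) (_ : Wd.IsGloballyMinimal),
        IsImaginaryQuadratic K ∧ Odd (NumberField.discr K) ∧ SatisfiesHeegnerHypothesis (W.conductorNorm ℤ) K ∧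
        SatisfiesHeegnerHypothesis 2 K ∧ (W.quadraticTwist (NumberField.discr K : ℚ)).entireLFunction 1 ≠ 0 ∧
        (∃ C : VariableChange ℚ, C • W.quadraticTwist (NumberField.discr K : ℚ) = Wd) ∧ MissingLowerBoundAt Wd 3) :
    LeafRankOneUpperAtThreeGlue :=
  fun hP _ hSig ↦ leafRankOneUpperAtThree_of_pubManin_of_namedFacts_of_sigmaStar_of_partnerLowerTwoSplit hP h37 hPT hF1 hSig hPL

/-! ## §5 The sources of PL₀|₂: L₀ (route member) and the leaf itself (tightness) -/

/-- **PL₀|₂ ⟸ L₀**: with the Friedberg–Hoffstein field (`2` and every `ℓ ∣ N_E` SPLIT, `L(E^{(d)},1) ≠ 0`; root number `−1` by modularity `hnf`)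
the minimal twist is a non-CM rank-zero LEAF curve (`leaf_twist_of_heegner`), so the route member L₀ = `Gss2LowerAtThreeRankZero` pays its lower half —
p634493's `partnerLower_of_lowerRankZero` keeping the datum «`2` splits». [cite: FriedbergHoffstein1995, Thm. B] [cite: Miller2011LMS, Def. 1.1] -/
theorem partnerLowerTwoSplit_of_lowerRankZero (hnf : exists_isNewformOf)
    (hFH : friedbergHoffstein_exists_heegnerField_splitDivisors_twist_ne_zero) (hL0 : Gss2LowerAtThreeRankZero)
    (W : WeierstrassCurve ℚ) [W.IsElliptic] [W.IsGloballyMinimal] (hCM : ¬ W.HasCM) (hadd : Addv W 3) (hsub : SubGss W 3)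
    (hr : W.analyticRank = 1) :
    ∃ (K : Type) (_ : Field K) (_ : NumberField K) (Wd : WeierstrassCurve ℚ) (_ : Wd.IsElliptic) (_ : Wd.IsGloballyMinimal),
      IsImaginaryQuadratic K ∧ Odd (NumberField.discr K) ∧ SatisfiesHeegnerHypothesis (W.conductorNorm ℤ) K ∧
      SatisfiesHeegnerHypothesis 2 K ∧ (W.quadraticTwist (NumberField.discr K : ℚ)).entireLFunction 1 ≠ 0 ∧
      (∃ C : VariableChange ℚ, C • W.quadraticTwist (NumberField.discr K : ℚ) = Wd) ∧ MissingLowerBoundAt Wd 3 := by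
  have hw : W.rootNumber = -1 := by
    rw [WeierstrassCurve.rootNumber_eq_neg_one_pow_analyticRank_of_exists_isNewformOf hnf W, hr]
    norm_num
  obtain ⟨K, _, _, hK, -, hHN, hH2, hLt⟩ := hFH W hw 2 two_ne_zero 4
  have hodd : Odd (NumberField.discr K) := by
    have h2 : ¬ ((2 : ℕ) : ℤ) ∣ NumberField.discr K :=
      Literature.SatisfiesHeegnerHypothesis.not_dvd_discr hK.1 hH2 Nat.prime_two (dvd_refl 2)
    rw [← Int.not_even_iff_odd, even_iff_two_dvd]
    exact_mod_cast h2
  have hD0 : (NumberField.discr K : ℚ) ≠ 0 := by exact_mod_cast NumberField.discr_ne_zero K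
  haveI hEt : (W.quadraticTwist (NumberField.discr K : ℚ)).IsElliptic := W.isElliptic_quadraticTwist hD0
  obtain ⟨Cd, hCd⟩ := hasGlobalMinimalModel_rat_holds (W.quadraticTwist (NumberField.discr K : ℚ))
  haveI : (Cd • W.quadraticTwist (NumberField.discr K : ℚ)).IsGloballyMinimal := hCd
  have hrd : (Cd • W.quadraticTwist (NumberField.discr K : ℚ)).analyticRank = 0 := by
    rw [analyticRank_smul]
    exact analyticRank_eq_zero_of_entireLFunction_one_ne_zero _ hLt
  obtain ⟨hCMd, haddd, hsubd, -⟩ := leaf_twist_of_heegner W hCM hadd hsub K hK hHN hodd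
    (Cd • W.quadraticTwist (NumberField.discr K : ℚ)) Cd rfl
  exact ⟨K, inferInstance, inferInstance, Cd • W.quadraticTwist (NumberField.discr K : ℚ), inferInstance, inferInstance, hK, hodd,
    hHN, hH2, hLt, ⟨Cd, rfl⟩, hL0 _ hCMd haddd hsubd hrd⟩

/-- **PL₀|₂ ⟸ the LEAF (tightness: no surplus).** From the rung leaf `WAllExclAddGssAtThree` (+ Friedberg–Hoffstein for the field with `2` split,
modularity for the root number, GZK for finiteness): the minimal twist is a rank-zero leaf curve, `BSD₃` holds for it by the leaf, hence its lower
half. So PL₀|₂ asks nothing beyond BSD₃ on the leaf. Nothing asserted (the leaf is a hypothesis). [cite: FriedbergHoffstein1995, Thm. B]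
[cite: Miller2011LMS, §1 and Def. 1.1] -/
theorem partnerLowerTwoSplit_of_wAllExclAddGssAtThree (hnf : exists_isNewformOf)
    (hFH : friedbergHoffstein_exists_heegnerField_splitDivisors_twist_ne_zero)
    (hGZK : rank_eq_analyticRank_of_analyticRank_le_one)
    (hleaf : Summit.BirchSwinnertonDyer.WAllExclAddGssAtThree)
    (W : WeierstrassCurve ℚ) [W.IsElliptic] [W.IsGloballyMinimal] (hCM : ¬ W.HasCM) (hadd : Addv W 3) (hsub : SubGss W 3)
    (hr : W.analyticRank = 1) :
    ∃ (K : Type) (_ : Field K) (_ : NumberField K) (Wd : WeierstrassCurve ℚ) (_ : Wd.IsElliptic) (_ : Wd.IsGloballyMinimal),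
      IsImaginaryQuadratic K ∧ Odd (NumberField.discr K) ∧ SatisfiesHeegnerHypothesis (W.conductorNorm ℤ) K ∧
      SatisfiesHeegnerHypothesis 2 K ∧ (W.quadraticTwist (NumberField.discr K : ℚ)).entireLFunction 1 ≠ 0 ∧
      (∃ C : VariableChange ℚ, C • W.quadraticTwist (NumberField.discr K : ℚ) = Wd) ∧ MissingLowerBoundAt Wd 3 := by
  refine partnerLowerTwoSplit_of_lowerRankZero hnf hFH ?_ W hCM hadd hsub hr
  intro V _ _ hCMV haddV hsubV hrV
  have hbsd : BSDp V 3 := hleaf V hCMV haddV hsubV (by rw [hrV]; exact zero_le_one)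
  haveI : Finite V.sha := (hGZK V (by rw [hrV]; exact zero_le_one)).2
  exact (Typed.lower_and_upper_of_missingPPartAt V 3 (Typed.missingPPartAt_of_bsdp V 3 hbsd)).1

end Summit.BirchSwinnertonDyer.BirchSwinnertonDyer.Theorems.RamifiedPairUpperBound

end
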